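import Literature.MathematicalPhysics.QuantumFieldTheory.ConformalBootstrap3D.PointKernelK34L505Data
import Literature.MathematicalPhysics.QuantumFieldTheory.ConformalBootstrap3D.PointKernelK34L505Segs

/-!
# K34L505 certificate, kernel block file E12: `ε`-row segments (interval coefficient rule; block checker `PCert.hBlockOKI` of `PointKernelInterval`, soundness `PCert.hBlockOKI_sound`), segments `39 ≤ i < 41`

`decide` by kernel reduction (no `native_decide`, no extra axioms) on the literal data of
`PointKernelK34L505Data`, on the certificate itself (full `s`-width) or on its piece certificates
`pcP_i = certK34L505.withS σ_i σ_(i+1) …` (the cell numbers on an `s`-piece; assembled by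
`CellFactIS_of_pieces`).  Estimated kernel time 225 s (6 theorems).
-/

set_option maxRecDepth 100000
set_option maxHeartbeats 0

namespace Literature.MathematicalPhysics.QuantumFieldTheory.ConformalBootstrap3D.PointKernelK34L505

open Literature.MathematicalPhysics.QuantumFieldTheory.ConformalBootstrap3D.PointKernel

/-- segment 39 of `esegsK34L505` passes the kernel evaluator on piece 6 of the 8-piece `s`-cover (≈36 s of kernel work). [folklore] -/
theorem eBlock_39_8_6 : pc8_6K34L505.hBlockOKI esegsK34L505 39 40 JEK34L505 = true := by
  decide +kernel

/-- segment 39 of `esegsK34L505` passes the kernel evaluator on piece 7 of the 8-piece `s`-cover (≈36 s of kernel work). [folklore] -/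
theorem eBlock_39_8_7 : pc8_7K34L505.hBlockOKI esegsK34L505 39 40 JEK34L505 = true := by
  decide +kernel

/-- segment 40 of `esegsK34L505` passes the kernel evaluator on piece 0 of the 8-piece `s`-cover (≈36 s of kernel work). [folklore] -/
theorem eBlock_40_8_0 : pc8_0K34L505.hBlockOKI esegsK34L505 40 41 JEK34L505 = true := by
  decide +kernel

/-- segment 40 of `esegsK34L505` passes the kernel evaluator on piece 1 of the 8-piece `s`-cover (≈36 s of kernel work). [folklore] -/
theorem eBlock_40_8_1 : pc8_1K34L505.hBlockOKI esegsK34L505 40 41 JEK34L505 = true := by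
  decide +kernel

/-- segment 40 of `esegsK34L505` passes the kernel evaluator on piece 2 of the 8-piece `s`-cover (≈36 s of kernel work). [folklore] -/
theorem eBlock_40_8_2 : pc8_2K34L505.hBlockOKI esegsK34L505 40 41 JEK34L505 = true := by
  decide +kernel

/-- segment 40 of `esegsK34L505` passes the kernel evaluator on piece 3 of the 8-piece `s`-cover (≈36 s of kernel work). [folklore] -/
theorem eBlock_40_8_3 : pc8_3K34L505.hBlockOKI esegsK34L505 40 41 JEK34L505 = true := by
  decide +kernel

end Literature.MathematicalPhysics.QuantumFieldTheory.ConformalBootstrap3D.PointKernelK34L505
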